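import Literature.NumberTheory.Rogawski1990.CMCharIdentityClauses
import Literature.NumberTheory.Rogawski1990.LocalTransferExistence
import Literature.NumberTheory.Rogawski1990.LocalTransferFundamentalLemma

/-!
# F0P3b — the junk obstruction to `LocalAPacket.CharIdentityAt` with `tr := IrrClass.smoothTrace`

`LocalAPacket.CharIdentityAt … P (fun c f => c.smoothTrace μG f) ξ μH T mH mG` quantifies the identity
`χ_ξ(f^H) = Σ_{π ∈ P} Tr π(f)` over EVERY `Δ`-matching pair `(f^H, f)` of bare functions.  The matching relation
`IsLocalDeltaTransfer` only sees orbital integrals at `G`-regular `γ_H`, whose matching classes avoid `γ = 1`;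
hence `(f^H, f + c·𝟙_{1})` matches whenever `(f^H, f)` does, while `f + 𝟙_{1}` and `f + 2·𝟙_{1}` cannot both be test
functions on a non-discrete group — so one of them has `smoothTrace = 0` (junk value) and the identity forces
`χ_ξ(f^H) = 0` and `Σ Tr π(f) = 0` on EVERY matching pair.  Consequence: together with transfer existence for test
functions the as-typed identity says every packet member has identically vanishing character.
Repair: restrict the identity to test functions (`f ∈ 𝒮(G′_v)`, `f^H ∈ 𝒮(H_v)`), as print does (`f ∈ C_c^∞`).
[cite: Rogawski1990, §13.1 Prop. 13.1.4 p. 199; §4.3 (4.3.1) p. 43; §4.9 Prop. 4.9.1 (a) p. 55]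
-/

noncomputable section

open MeasureTheory NumberField IsDedekindDomain Topology
open scoped Matrix MatrixGroups

namespace Summit.HodgeConjecture.HodgeConjecture.Cruxes.H413.F0P3bQCMJunkObstruction

open Literature.NumberTheory.Rogawski1990 Literature.NumberTheory.Automorphic Literature.MeasureTheory.Group
open Literature.NumberTheory.Automorphic.UnitaryGroup Literature.NumberTheory.Automorphic.UnitaryGroup.CotangentForms
open Literature.NumberTheory.GaloisRepresentations Literature.NumberTheory.Automorphic.Arthur2013.Leaves.TECR

/-! ## §1 Abstract: twisting `f` at the identity preserves every `Δ`-matching -/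

section Abstract

variable {A B : Type*} [Group A] [Group B]
  [∀ a : A, MeasurableSpace (A ⧸ Subgroup.centralizer ({a} : Set A))]
  [∀ b : B, MeasurableSpace (B ⧸ Subgroup.centralizer ({b} : Set B))]

omit [∀ b : B, MeasurableSpace (B ⧸ Subgroup.centralizer ({b} : Set B))] in
/-- A conjugate of a non-identity element is not the identity. [folklore] -/
theorem conj_ne_one {γ : B} (hγ : γ ≠ 1) (y : B) : y * γ * y⁻¹ ≠ 1 := by
  intro h
  apply hγ
  have h' : y * γ = y := by
    have := congrArg (· * y) h
    simpa [mul_assoc] using this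
  simpa using mul_left_cancel (h'.trans (mul_one y).symm)

/-- The orbital integral at `γ ≠ 1` does not see a modification of `f` at `1`. [cite: Rogawski1990, §4.9 p. 54] -/
theorem orbitalIntegral_add_indicator_one (γ : B) (hγ : γ ≠ 1) (f : B → ℂ) (c : ℂ)
    (m : Measure (B ⧸ Subgroup.centralizer ({γ} : Set B))) :
    orbitalIntegral γ (f + Set.indicator {1} (fun _ => c)) m = orbitalIntegral γ f m := by
  unfold orbitalIntegral
  congr 1
  funext y
  induction y using QuotientGroup.induction_on with
  | H y =>
    rw [descConj_mk, descConj_mk, Pi.add_apply,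
      Set.indicator_of_notMem (by simpa using conj_ne_one hγ y), add_zero]

/-- Same for the class orbital integral at a class `≠ {1}`. [cite: Rogawski1990, §4.9 p. 54] -/
theorem classOrbitalIntegral_add_indicator_one (m : OrbitalMeasureFamily B) (f : B → ℂ) (c : ℂ) (k : ConjClasses B)
    (hk : Quotient.out k ≠ (1 : B)) :
    classOrbitalIntegral m (f + Set.indicator {1} (fun _ => c)) k = classOrbitalIntegral m f k :=
  orbitalIntegral_add_indicator_one _ hk f c (m k)

variable {R : A → B → Prop} {stA : A → A → Prop} {regA : A → Prop}

/-- **Twist invariance of the matching**: if `regA`-elements never match `1 ∈ B`, then `(f^H, f + c·𝟙_{1})` is a `Δ`-matching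
pair whenever `(f^H, f)` is. [cite: Rogawski1990, §4.3 (4.3.1) p. 43] -/
theorem isDeltaTransferRel_add_indicator_one (T : TransferFactorData A B R) (mH : OrbitalMeasureFamily A)
    (mG : OrbitalMeasureFamily B) (hR1 : ∀ a, regA a → ¬ R a 1) {fH : A → ℂ} {f : B → ℂ}
    (h : IsDeltaTransferRel R stA regA T mH mG fH f) (c : ℂ) :
    IsDeltaTransferRel R stA regA T mH mG fH (f + Set.indicator {1} (fun _ => c)) := by
  intro a ha
  rw [h a ha]
  refine finsum_congr fun k => ?_
  by_cases hk : Quotient.out k = (1 : B)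
  · have hΔ : T.Δ a (Quotient.out k) = 0 := T.eq_zero_of_not_rel a _ (by rw [hk]; exact hR1 a ha)
    rw [hΔ, zero_mul, zero_mul]
  · rw [classOrbitalIntegral_add_indicator_one mG f c k hk]

end Abstract

/-! ## §2 Test functions: `𝟙_{1}` is not Schwartz–Bruhat on a non-discrete group -/

section Test

variable {B : Type*} [Group B] [TopologicalSpace B]

/-- On a group whose identity is not isolated, `c·𝟙_{1}` (`c ≠ 0`) is not locally constant, hence not a test function.
[cite: Rogawski1990, §1.6 p. 6] -/
theorem indicator_one_not_mem_schwartzBruhat (h1 : ¬ IsOpen ({1} : Set B)) {c : ℂ} (hc : c ≠ 0) :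
    Set.indicator ({1} : Set B) (fun _ => c) ∉ SchwartzBruhat B := by
  intro h
  apply h1
  have hlc : IsLocallyConstant (Set.indicator ({1} : Set B) (fun _ => c)) := (mem_schwartzBruhat_iff.1 h).1
  have hfib : (Set.indicator ({1} : Set B) (fun _ => c)) ⁻¹' {c} = {1} := by
    ext x
    by_cases hx : x = 1
    · simp [hx]
    · simp [hx, hc.symm]
  rw [← hfib]
  exact hlc.isOpen_fiber c

/-- Of `f + 𝟙_{1}` and `f + 𝟙_{1} + 𝟙_{1}` at least one is not a test function. [cite: Rogawski1990, §1.6 p. 6] -/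
theorem not_mem_schwartzBruhat_or (h1 : ¬ IsOpen ({1} : Set B)) (f : B → ℂ) :
    f + Set.indicator {1} (fun _ => (1 : ℂ)) ∉ SchwartzBruhat B ∨
      f + Set.indicator {1} (fun _ => (1 : ℂ)) + Set.indicator {1} (fun _ => (1 : ℂ)) ∉ SchwartzBruhat B := by
  by_contra h
  push Not at h
  have hg := (SchwartzBruhat B).sub_mem h.2 h.1
  rw [add_sub_cancel_left] at hg
  exact indicator_one_not_mem_schwartzBruhat h1 one_ne_zero hg

end Test

/-! ## §3 The CM-local character identity forces vanishing on every matching pair -/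

section CM

variable (L : Type) [Field L] [NumberField L] [IsCMField L] (H' : Matrix (Fin 3) (Fin 3) L)
  (v : HeightOneSpectrum (𝓞 ↥(maximalRealSubfield L)))

/-- `traceSum` vanishes when every member trace does. [cite: Rogawski1990, §12.3 Prop. 12.3.3 (a) p. 178] -/
theorem traceSum_eq_zero_of_forall {C TG : Type*} (P : LocalAPacket C) (tr : C → TG → ℂ) (f : TG)
    (h : ∀ c, tr c f = 0) : P.traceSum tr f = 0 := by
  rcases hs : P.πs with _ | c
  · rw [P.traceSum_of_πs_eq_none _ _ hs, h]
  · rw [P.traceSum_of_πs_eq_some _ _ hs, h, h, add_zero]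

/-- **A `G`-regular `γ_H` never matches `γ = 1`** (`ι_v(γ_H) ↔ 1` forces `charpoly ι_v(γ_H) = (X − 1)³`, not separable).
[cite: Rogawski1990, §4.3 p. 42; §14.1 p. 232] -/
theorem not_isLocalNormPair_one
    (a : (UnitaryGroup.cmDatum L 2 (Matrix.of fun i j : Fin 2 => if i.val + j.val + 1 = 2 then (1 : L) else 0)).Local v ×
      (UnitaryGroup.cmDatum L 1 (Matrix.of fun i j : Fin 1 => if i.val + j.val + 1 = 1 then (1 : L) else 0)).Local v)
    (ha : IsLocalGRegular L v a) : ¬ IsLocalNormPair L H' v a 1 := by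
  intro h
  obtain ⟨w⟩ := (inferInstance : Nonempty (UnitaryGroup.PlacesOver L v))
  letI : Inhabited (UnitaryGroup.PlacesOver L v) := ⟨w⟩
  haveI : Nontrivial (UnitaryGroup.LocalRing L v) := inferInstance
  have hc := Corresponds.charpoly_eq ((isLocalNormPair_iff L H' v a 1).1 h)
  have hsep : (Matrix.charpoly ((endoEmbLocal L v a).val.val)).Separable := ha
  rw [hc] at hsep
  have h1 : ((1 : (UnitaryGroup.cmDatum L 3 H').Local v).val.val : Matrix (Fin 3) (Fin 3) (UnitaryGroup.LocalRing L v)) = 1 := by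
    rfl
  rw [h1, Matrix.charpoly_one, Fintype.card_fin] at hsep
  have hnu : ¬ IsUnit (Polynomial.X - 1 : Polynomial (UnitaryGroup.LocalRing L v)) := by
    rw [← Polynomial.C_1]
    exact Polynomial.not_isUnit_X_sub_C 1
  exact absurd (Polynomial.Separable.of_pow hnu (by norm_num) hsep).2 (by norm_num)

variable [MeasurableSpace ((UnitaryGroup.cmDatum L 3 H').Local v)]
  [MeasurableSpace ((UnitaryGroup.cmDatum L 2 (Matrix.of fun i j : Fin 2 => if i.val + j.val + 1 = 2 then (1 : L) else 0)).Local v ×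
    (UnitaryGroup.cmDatum L 1 (Matrix.of fun i j : Fin 1 => if i.val + j.val + 1 = 1 then (1 : L) else 0)).Local v)]
  [∀ a : ((UnitaryGroup.cmDatum L 2 (Matrix.of fun i j : Fin 2 => if i.val + j.val + 1 = 2 then (1 : L) else 0)).Local v ×
      (UnitaryGroup.cmDatum L 1 (Matrix.of fun i j : Fin 1 => if i.val + j.val + 1 = 1 then (1 : L) else 0)).Local v),
    MeasurableSpace (((UnitaryGroup.cmDatum L 2 (Matrix.of fun i j : Fin 2 => if i.val + j.val + 1 = 2 then (1 : L) else 0)).Local v ×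
        (UnitaryGroup.cmDatum L 1 (Matrix.of fun i j : Fin 1 => if i.val + j.val + 1 = 1 then (1 : L) else 0)).Local v) ⧸
      Subgroup.centralizer ({a} : Set ((UnitaryGroup.cmDatum L 2 (Matrix.of fun i j : Fin 2 => if i.val + j.val + 1 = 2 then (1 : L) else 0)).Local v ×
        (UnitaryGroup.cmDatum L 1 (Matrix.of fun i j : Fin 1 => if i.val + j.val + 1 = 1 then (1 : L) else 0)).Local v)))]
  [∀ γ : (UnitaryGroup.cmDatum L 3 H').Local v,
    MeasurableSpace ((UnitaryGroup.cmDatum L 3 H').Local v ⧸ Subgroup.centralizer ({γ} : Set ((UnitaryGroup.cmDatum L 3 H').Local v)))]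

omit [MeasurableSpace ((UnitaryGroup.cmDatum L 3 H').Local v)]
  [MeasurableSpace ((UnitaryGroup.cmDatum L 2 (Matrix.of fun i j : Fin 2 => if i.val + j.val + 1 = 2 then (1 : L) else 0)).Local v ×
    (UnitaryGroup.cmDatum L 1 (Matrix.of fun i j : Fin 1 => if i.val + j.val + 1 = 1 then (1 : L) else 0)).Local v)] in
/-- **Twist invariance on the CM carriers**: `(f^H_v, f_v + c·𝟙_{1})` is a `Δ_v`-matching pair whenever `(f^H_v, f_v)` is.
[cite: Rogawski1990, §4.3 (4.3.1) p. 43] -/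
theorem isLocalDeltaTransfer_add_indicator_one (T : LocalTransferFactor L H' v)
    (mH : OrbitalMeasureFamily ((UnitaryGroup.cmDatum L 2 (Matrix.of fun i j : Fin 2 => if i.val + j.val + 1 = 2 then (1 : L) else 0)).Local v ×
      (UnitaryGroup.cmDatum L 1 (Matrix.of fun i j : Fin 1 => if i.val + j.val + 1 = 1 then (1 : L) else 0)).Local v))
    (mG : OrbitalMeasureFamily ((UnitaryGroup.cmDatum L 3 H').Local v))
    {fH : (UnitaryGroup.cmDatum L 2 (Matrix.of fun i j : Fin 2 => if i.val + j.val + 1 = 2 then (1 : L) else 0)).Local v ×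
      (UnitaryGroup.cmDatum L 1 (Matrix.of fun i j : Fin 1 => if i.val + j.val + 1 = 1 then (1 : L) else 0)).Local v → ℂ}
    {f : (UnitaryGroup.cmDatum L 3 H').Local v → ℂ} (h : IsLocalDeltaTransfer L H' v T mH mG fH f) (c : ℂ) :
    IsLocalDeltaTransfer L H' v T mH mG fH (f + Set.indicator {1} (fun _ => c)) :=
  isDeltaTransferRel_add_indicator_one T mH mG (fun a ha => not_isLocalNormPair_one L H' v a ha) h c

/-- **THE OBSTRUCTION.**  If the identity of `G′_v` is not isolated (always: `G′_v` is a non-discrete `p`-adic group), the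
as-typed character identity `P.CharIdentityAt … (fun c f => c.smoothTrace μG f) …` forces `χ_ξ(f^H) = 0` AND
`Σ_{π ∈ P} Tr π(f) = 0` on EVERY `Δ_v`-matching pair `(f^H, f)`. [cite: Rogawski1990, §13.1 Prop. 13.1.4 p. 199] -/
theorem charIdentityAt_forces_zero (h1 : ¬ IsOpen ({1} : Set ((UnitaryGroup.cmDatum L 3 H').Local v)))
    (P : CMLocalAPacket L H' v) (μG : Measure ((UnitaryGroup.cmDatum L 3 H').Local v))
    (ξ : (UnitaryGroup.cmDatum L 2 (Matrix.of fun i j : Fin 2 => if i.val + j.val + 1 = 2 then (1 : L) else 0)).Local v ×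
        (UnitaryGroup.cmDatum L 1 (Matrix.of fun i j : Fin 1 => if i.val + j.val + 1 = 1 then (1 : L) else 0)).Local v →* ℂˣ)
    (μH : Measure ((UnitaryGroup.cmDatum L 2 (Matrix.of fun i j : Fin 2 => if i.val + j.val + 1 = 2 then (1 : L) else 0)).Local v ×
        (UnitaryGroup.cmDatum L 1 (Matrix.of fun i j : Fin 1 => if i.val + j.val + 1 = 1 then (1 : L) else 0)).Local v))
    (T : LocalTransferFactor L H' v)
    (mH : OrbitalMeasureFamily ((UnitaryGroup.cmDatum L 2 (Matrix.of fun i j : Fin 2 => if i.val + j.val + 1 = 2 then (1 : L) else 0)).Local v ×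
        (UnitaryGroup.cmDatum L 1 (Matrix.of fun i j : Fin 1 => if i.val + j.val + 1 = 1 then (1 : L) else 0)).Local v))
    (mG : OrbitalMeasureFamily ((UnitaryGroup.cmDatum L 3 H').Local v))
    (hP : P.CharIdentityAt L H' v (fun c f => c.smoothTrace μG f) ξ μH T mH mG)
    {fH : (UnitaryGroup.cmDatum L 2 (Matrix.of fun i j : Fin 2 => if i.val + j.val + 1 = 2 then (1 : L) else 0)).Local v ×
      (UnitaryGroup.cmDatum L 1 (Matrix.of fun i j : Fin 1 => if i.val + j.val + 1 = 1 then (1 : L) else 0)).Local v → ℂ}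
    {f : (UnitaryGroup.cmDatum L 3 H').Local v → ℂ} (hm : IsLocalDeltaTransfer L H' v T mH mG fH f) :
    charDist ξ μH fH = 0 ∧ P.traceSum (fun c f => c.smoothTrace μG f) f = 0 := by
  have hm1 := isLocalDeltaTransfer_add_indicator_one L H' v T mH mG hm 1
  have hm2 := isLocalDeltaTransfer_add_indicator_one L H' v T mH mG hm1 1
  have e0 : charDist ξ μH fH = P.traceSum (fun c f => c.smoothTrace μG f) f := hP fH f hm
  have hz : charDist ξ μH fH = 0 := by
    rcases not_mem_schwartzBruhat_or h1 f with hn | hn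
    · rw [hP fH _ hm1]
      exact traceSum_eq_zero_of_forall P _ _ fun c => IrrClass.smoothTrace_of_not_mem c μG hn
    · rw [hP fH _ hm2]
      exact traceSum_eq_zero_of_forall P _ _ fun c => IrrClass.smoothTrace_of_not_mem c μG hn
  exact ⟨hz, e0 ▸ hz⟩

/-- **Corollary (refutation shape)**: ONE matching pair with `Σ Tr π(f) ≠ 0` refutes the as-typed identity.
[cite: Rogawski1990, §13.1 Prop. 13.1.4 p. 199] -/
theorem not_charIdentityAt_of_witness (h1 : ¬ IsOpen ({1} : Set ((UnitaryGroup.cmDatum L 3 H').Local v)))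
    (P : CMLocalAPacket L H' v) (μG : Measure ((UnitaryGroup.cmDatum L 3 H').Local v))
    (ξ : (UnitaryGroup.cmDatum L 2 (Matrix.of fun i j : Fin 2 => if i.val + j.val + 1 = 2 then (1 : L) else 0)).Local v ×
        (UnitaryGroup.cmDatum L 1 (Matrix.of fun i j : Fin 1 => if i.val + j.val + 1 = 1 then (1 : L) else 0)).Local v →* ℂˣ)
    (μH : Measure ((UnitaryGroup.cmDatum L 2 (Matrix.of fun i j : Fin 2 => if i.val + j.val + 1 = 2 then (1 : L) else 0)).Local v ×
        (UnitaryGroup.cmDatum L 1 (Matrix.of fun i j : Fin 1 => if i.val + j.val + 1 = 1 then (1 : L) else 0)).Local v))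
    (T : LocalTransferFactor L H' v)
    (mH : OrbitalMeasureFamily ((UnitaryGroup.cmDatum L 2 (Matrix.of fun i j : Fin 2 => if i.val + j.val + 1 = 2 then (1 : L) else 0)).Local v ×
        (UnitaryGroup.cmDatum L 1 (Matrix.of fun i j : Fin 1 => if i.val + j.val + 1 = 1 then (1 : L) else 0)).Local v))
    (mG : OrbitalMeasureFamily ((UnitaryGroup.cmDatum L 3 H').Local v))
    (hw : ∃ fH f, IsLocalDeltaTransfer L H' v T mH mG fH f ∧ P.traceSum (fun c f => c.smoothTrace μG f) f ≠ 0) :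
    ¬ P.CharIdentityAt L H' v (fun c f => c.smoothTrace μG f) ξ μH T mH mG := by
  rintro hP
  obtain ⟨fH, f, hm, hne⟩ := hw
  exact hne (charIdentityAt_forces_zero L H' v h1 P μG ξ μH T mH mG hP hm).2

/-- **With transfer existence for a class `SmoothG` of `G`-side test functions** (e.g. `IsLocSmooth`, as in ★ `LocalTransferExplicit`),
the as-typed identity makes the packet character vanish on ALL of `SmoothG`. [cite: Rogawski1990, §4.9 Prop. 4.9.1 (a) p. 55; §13.1 Prop. 13.1.4 p. 199] -/
theorem traceSum_eq_zero_of_transferExists (h1 : ¬ IsOpen ({1} : Set ((UnitaryGroup.cmDatum L 3 H').Local v)))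
    (P : CMLocalAPacket L H' v) (μG : Measure ((UnitaryGroup.cmDatum L 3 H').Local v))
    (ξ : (UnitaryGroup.cmDatum L 2 (Matrix.of fun i j : Fin 2 => if i.val + j.val + 1 = 2 then (1 : L) else 0)).Local v ×
        (UnitaryGroup.cmDatum L 1 (Matrix.of fun i j : Fin 1 => if i.val + j.val + 1 = 1 then (1 : L) else 0)).Local v →* ℂˣ)
    (μH : Measure ((UnitaryGroup.cmDatum L 2 (Matrix.of fun i j : Fin 2 => if i.val + j.val + 1 = 2 then (1 : L) else 0)).Local v ×
        (UnitaryGroup.cmDatum L 1 (Matrix.of fun i j : Fin 1 => if i.val + j.val + 1 = 1 then (1 : L) else 0)).Local v))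
    (T : LocalTransferFactor L H' v)
    (mH : OrbitalMeasureFamily ((UnitaryGroup.cmDatum L 2 (Matrix.of fun i j : Fin 2 => if i.val + j.val + 1 = 2 then (1 : L) else 0)).Local v ×
        (UnitaryGroup.cmDatum L 1 (Matrix.of fun i j : Fin 1 => if i.val + j.val + 1 = 1 then (1 : L) else 0)).Local v))
    (mG : OrbitalMeasureFamily ((UnitaryGroup.cmDatum L 3 H').Local v))
    {SmoothG : ((UnitaryGroup.cmDatum L 3 H').Local v → ℂ) → Prop}
    {SmoothH : ((UnitaryGroup.cmDatum L 2 (Matrix.of fun i j : Fin 2 => if i.val + j.val + 1 = 2 then (1 : L) else 0)).Local v ×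
        (UnitaryGroup.cmDatum L 1 (Matrix.of fun i j : Fin 1 => if i.val + j.val + 1 = 1 then (1 : L) else 0)).Local v → ℂ) → Prop}
    (hE : IsLocalDeltaTransferExists L H' v T mH mG SmoothG SmoothH)
    (hP : P.CharIdentityAt L H' v (fun c f => c.smoothTrace μG f) ξ μH T mH mG)
    (f : (UnitaryGroup.cmDatum L 3 H').Local v → ℂ) (hf : SmoothG f) :
    P.traceSum (fun c f => c.smoothTrace μG f) f = 0 := by
  obtain ⟨fH, -, hm⟩ := hE f hf
  exact (charIdentityAt_forces_zero L H' v h1 P μG ξ μH T mH mG hP hm).2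

end CM

/-! ## §4 Read at the CM clauses of record (`CMSplitCharIdentityAt`, `CMNonsplitCharIdentityAt`, `CMCharIdentityPackage`) -/

section Clauses

variable {L : Type} [Field L] [NumberField L] [IsCMField L] {H' : Matrix (Fin 3) (Fin 3) L}
  {v : HeightOneSpectrum (𝓞 ↥(maximalRealSubfield L))}
  [MeasurableSpace ((UnitaryGroup.cmDatum L 3 H').Local v)]
  [MeasurableSpace ((UnitaryGroup.cmDatum L 2 (Matrix.of fun i j : Fin 2 => if i.val + j.val + 1 = 2 then (1 : L) else 0)).Local v ×
      (UnitaryGroup.cmDatum L 1 (Matrix.of fun i j : Fin 1 => if i.val + j.val + 1 = 1 then (1 : L) else 0)).Local v)]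
  [∀ a : ((UnitaryGroup.cmDatum L 2 (Matrix.of fun i j : Fin 2 => if i.val + j.val + 1 = 2 then (1 : L) else 0)).Local v ×
      (UnitaryGroup.cmDatum L 1 (Matrix.of fun i j : Fin 1 => if i.val + j.val + 1 = 1 then (1 : L) else 0)).Local v),
    MeasurableSpace (((UnitaryGroup.cmDatum L 2 (Matrix.of fun i j : Fin 2 => if i.val + j.val + 1 = 2 then (1 : L) else 0)).Local v ×
      (UnitaryGroup.cmDatum L 1 (Matrix.of fun i j : Fin 1 => if i.val + j.val + 1 = 1 then (1 : L) else 0)).Local v) ⧸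
      Subgroup.centralizer ({a} : Set ((UnitaryGroup.cmDatum L 2 (Matrix.of fun i j : Fin 2 => if i.val + j.val + 1 = 2 then (1 : L) else 0)).Local v ×
      (UnitaryGroup.cmDatum L 1 (Matrix.of fun i j : Fin 1 => if i.val + j.val + 1 = 1 then (1 : L) else 0)).Local v)))]
  [∀ γ : (UnitaryGroup.cmDatum L 3 H').Local v,
    MeasurableSpace ((UnitaryGroup.cmDatum L 3 H').Local v ⧸ Subgroup.centralizer ({γ} : Set ((UnitaryGroup.cmDatum L 3 H').Local v)))]
  {T : LocalTransferFactor L H' v} {mH : OrbitalMeasureFamily ((UnitaryGroup.cmDatum L 2 (Matrix.of fun i j : Fin 2 => if i.val + j.val + 1 = 2 then (1 : L) else 0)).Local v ×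
      (UnitaryGroup.cmDatum L 1 (Matrix.of fun i j : Fin 1 => if i.val + j.val + 1 = 1 then (1 : L) else 0)).Local v)}
  {mG : OrbitalMeasureFamily ((UnitaryGroup.cmDatum L 3 H').Local v)} {μG : Measure ((UnitaryGroup.cmDatum L 3 H').Local v)}
  {μH : Measure ((UnitaryGroup.cmDatum L 2 (Matrix.of fun i j : Fin 2 => if i.val + j.val + 1 = 2 then (1 : L) else 0)).Local v ×
      (UnitaryGroup.cmDatum L 1 (Matrix.of fun i j : Fin 1 => if i.val + j.val + 1 = 1 then (1 : L) else 0)).Local v)}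
  {ξv : (UnitaryGroup.cmDatum L 2 (Matrix.of fun i j : Fin 2 => if i.val + j.val + 1 = 2 then (1 : L) else 0)).Local v ×
      (UnitaryGroup.cmDatum L 1 (Matrix.of fun i j : Fin 1 => if i.val + j.val + 1 = 1 then (1 : L) else 0)).Local v →* ℂˣ}

/-- **Split clause ⇒ the split member's character vanishes on every matched `f`** (and `χ_ξ(f^H) = 0`).
[cite: Rogawski1990, §4.13 Lemma 4.13.1 (b); §13.1 Prop. 13.1.4 p. 199] -/
theorem cmSplitCharIdentityAt_forces_zero (h1 : ¬ IsOpen ({1} : Set ((UnitaryGroup.cmDatum L 3 H').Local v)))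
    {hH' : (H'.map (cmConjRingHom L))ᵀ = H'} {hH'd : IsUnit H'.det}
    {w : UnitaryGroup.PlacesOver L v} {hw : IsCMField.complexConj L • w.1 ≠ w.1}
    [LocallyCompactSpace (standardParabolicGL (w.1.adicCompletion L) (Zelevinsky1980.lastBlockLabel 3))]
    {ν₀ χ' : (w.1.adicCompletion L)ˣ →* ℂˣ} {hν₀u : ∀ x, ‖((ν₀ x : ℂˣ) : ℂ)‖ = 1}
    {hν₀c : Continuous fun x => ((ν₀ x : ℂˣ) : ℂ)} {hχ'u : ∀ x, ‖((χ' x : ℂˣ) : ℂ)‖ = 1}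
    {hχ'c : Continuous fun x => ((χ' x : ℂˣ) : ℂ)}
    (hS : CMSplitCharIdentityAt L v H' hH' hH'd w hw ν₀ χ' hν₀u hν₀c hχ'u hχ'c T mH mG μG μH ξv)
    {fH : (UnitaryGroup.cmDatum L 2 (Matrix.of fun i j : Fin 2 => if i.val + j.val + 1 = 2 then (1 : L) else 0)).Local v ×
      (UnitaryGroup.cmDatum L 1 (Matrix.of fun i j : Fin 1 => if i.val + j.val + 1 = 1 then (1 : L) else 0)).Local v → ℂ} {f : (UnitaryGroup.cmDatum L 3 H').Local v → ℂ} (hm : IsLocalDeltaTransfer L H' v T mH mG fH f) :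
    charDist ξv μH fH = 0 ∧
      ((cmSplitPacket L H' hH' hH'd v w hw ν₀ χ' hν₀u hν₀c hχ'u hχ'c).πn).smoothTrace μG f = 0 := by
  have h := charIdentityAt_forces_zero L H' v h1 _ μG ξv μH T mH mG hS hm
  refine ⟨h.1, ?_⟩
  have h2 := h.2
  rwa [LocalAPacket.traceSum_of_πs_eq_none _ _ _ (cmSplitPacket_πs L H' hH' hH'd v w hw ν₀ χ' hν₀u hν₀c hχ'u hχ'c)] at h2

/-- **Non-split clause ⇒ `Tr πⁿ(f) + Tr πˢ(f) = 0` on every matched `f`** (and `χ_ξ(f^H) = 0`).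
[cite: Rogawski1990, §13.1 Prop. 13.1.4 p. 199] -/
theorem cmNonsplitCharIdentityAt_forces_zero (h1 : ¬ IsOpen ({1} : Set ((UnitaryGroup.cmDatum L 3 H').Local v)))
    {πn : IrrClass ((UnitaryGroup.cmDatum L 3 H').Local v)} (hN : CMNonsplitCharIdentityAt L v H' T mH mG μG μH ξv πn)
    {fH : (UnitaryGroup.cmDatum L 2 (Matrix.of fun i j : Fin 2 => if i.val + j.val + 1 = 2 then (1 : L) else 0)).Local v ×
      (UnitaryGroup.cmDatum L 1 (Matrix.of fun i j : Fin 1 => if i.val + j.val + 1 = 1 then (1 : L) else 0)).Local v → ℂ} {f : (UnitaryGroup.cmDatum L 3 H').Local v → ℂ} (hm : IsLocalDeltaTransfer L H' v T mH mG fH f) :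
    charDist ξv μH fH = 0 ∧ πn.smoothTrace μG f + hN.πs.smoothTrace μG f = 0 := by
  have h := charIdentityAt_forces_zero L H' v h1 _ μG ξv μH T mH mG hN.charIdentityAt_πs hm
  refine ⟨h.1, ?_⟩
  have h2 := h.2
  rwa [LocalAPacket.traceSum_of_πs_eq_some _ _ _ (c := hN.πs) rfl] at h2

/-- **Split clause + transfer existence for test functions ⇒ `Tr i_G(ξ̃_v)(f dμ_G) = 0` for EVERY test `f`** — the absurd consequence
(print: `Tr π(𝟙_K dμ_G) = vol(K)·dim V^K > 0`, ★ `Representation.smoothTrace_indicator`).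
[cite: Rogawski1990, §4.9 Prop. 4.9.1 (a) p. 55; §4.13 Lemma 4.13.1 (b); §13.1 Prop. 13.1.4 p. 199] -/
theorem cmSplit_member_trace_vanishes (h1 : ¬ IsOpen ({1} : Set ((UnitaryGroup.cmDatum L 3 H').Local v)))
    {hH' : (H'.map (cmConjRingHom L))ᵀ = H'} {hH'd : IsUnit H'.det}
    {w : UnitaryGroup.PlacesOver L v} {hw : IsCMField.complexConj L • w.1 ≠ w.1}
    [LocallyCompactSpace (standardParabolicGL (w.1.adicCompletion L) (Zelevinsky1980.lastBlockLabel 3))]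
    {ν₀ χ' : (w.1.adicCompletion L)ˣ →* ℂˣ} {hν₀u : ∀ x, ‖((ν₀ x : ℂˣ) : ℂ)‖ = 1}
    {hν₀c : Continuous fun x => ((ν₀ x : ℂˣ) : ℂ)} {hχ'u : ∀ x, ‖((χ' x : ℂˣ) : ℂ)‖ = 1}
    {hχ'c : Continuous fun x => ((χ' x : ℂˣ) : ℂ)}
    (hS : CMSplitCharIdentityAt L v H' hH' hH'd w hw ν₀ χ' hν₀u hν₀c hχ'u hχ'c T mH mG μG μH ξv)
    {SmoothG : ((UnitaryGroup.cmDatum L 3 H').Local v → ℂ) → Prop} {SmoothH : ((UnitaryGroup.cmDatum L 2 (Matrix.of fun i j : Fin 2 => if i.val + j.val + 1 = 2 then (1 : L) else 0)).Local v ×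
      (UnitaryGroup.cmDatum L 1 (Matrix.of fun i j : Fin 1 => if i.val + j.val + 1 = 1 then (1 : L) else 0)).Local v → ℂ) → Prop}
    (hE : IsLocalDeltaTransferExists L H' v T mH mG SmoothG SmoothH)
    (f : (UnitaryGroup.cmDatum L 3 H').Local v → ℂ) (hf : SmoothG f) :
    ((cmSplitPacket L H' hH' hH'd v w hw ν₀ χ' hν₀u hν₀c hχ'u hχ'c).πn).smoothTrace μG f = 0 := by
  obtain ⟨fH, -, hm⟩ := hE f hf
  exact (cmSplitCharIdentityAt_forces_zero h1 hS hm).2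

/-- **Non-split clause + transfer existence ⇒ `Tr πⁿ(f) + Tr πˢ(f) = 0` for EVERY test `f`.** [cite: Rogawski1990, §13.1 Prop. 13.1.4 p. 199] -/
theorem cmNonsplit_member_traces_vanish (h1 : ¬ IsOpen ({1} : Set ((UnitaryGroup.cmDatum L 3 H').Local v)))
    {πn : IrrClass ((UnitaryGroup.cmDatum L 3 H').Local v)} (hN : CMNonsplitCharIdentityAt L v H' T mH mG μG μH ξv πn)
    {SmoothG : ((UnitaryGroup.cmDatum L 3 H').Local v → ℂ) → Prop} {SmoothH : ((UnitaryGroup.cmDatum L 2 (Matrix.of fun i j : Fin 2 => if i.val + j.val + 1 = 2 then (1 : L) else 0)).Local v ×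
      (UnitaryGroup.cmDatum L 1 (Matrix.of fun i j : Fin 1 => if i.val + j.val + 1 = 1 then (1 : L) else 0)).Local v → ℂ) → Prop}
    (hE : IsLocalDeltaTransferExists L H' v T mH mG SmoothG SmoothH)
    (f : (UnitaryGroup.cmDatum L 3 H').Local v → ℂ) (hf : SmoothG f) :
    πn.smoothTrace μG f + hN.πs.smoothTrace μG f = 0 := by
  obtain ⟨fH, -, hm⟩ := hE f hf
  exact (cmNonsplitCharIdentityAt_forces_zero h1 hN hm).2

end Clauses

section Package

variable {L : Type} [Field L] [NumberField L] [IsCMField L] {H : Matrix (Fin 3) (Fin 3) L}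
  {hH : (H.map (cmConjRingHom L))ᵀ = H} {hHd : IsUnit H.det}
  [∀ v : HeightOneSpectrum (𝓞 ↥(maximalRealSubfield L)), MeasurableSpace ((UnitaryGroup.cmDatum L 3 H).Local v)]
  [∀ v : HeightOneSpectrum (𝓞 ↥(maximalRealSubfield L)), MeasurableSpace ((UnitaryGroup.cmDatum L 2 (Matrix.of fun i j : Fin 2 => if i.val + j.val + 1 = 2 then (1 : L) else 0)).Local v ×
      (UnitaryGroup.cmDatum L 1 (Matrix.of fun i j : Fin 1 => if i.val + j.val + 1 = 1 then (1 : L) else 0)).Local v)]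
  [∀ (v : HeightOneSpectrum (𝓞 ↥(maximalRealSubfield L))) (a : ((UnitaryGroup.cmDatum L 2 (Matrix.of fun i j : Fin 2 => if i.val + j.val + 1 = 2 then (1 : L) else 0)).Local v ×
      (UnitaryGroup.cmDatum L 1 (Matrix.of fun i j : Fin 1 => if i.val + j.val + 1 = 1 then (1 : L) else 0)).Local v)),
    MeasurableSpace (((UnitaryGroup.cmDatum L 2 (Matrix.of fun i j : Fin 2 => if i.val + j.val + 1 = 2 then (1 : L) else 0)).Local v ×
      (UnitaryGroup.cmDatum L 1 (Matrix.of fun i j : Fin 1 => if i.val + j.val + 1 = 1 then (1 : L) else 0)).Local v) ⧸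
      Subgroup.centralizer ({a} : Set ((UnitaryGroup.cmDatum L 2 (Matrix.of fun i j : Fin 2 => if i.val + j.val + 1 = 2 then (1 : L) else 0)).Local v ×
      (UnitaryGroup.cmDatum L 1 (Matrix.of fun i j : Fin 1 => if i.val + j.val + 1 = 1 then (1 : L) else 0)).Local v)))]
  [∀ (v : HeightOneSpectrum (𝓞 ↥(maximalRealSubfield L))) (γ : (UnitaryGroup.cmDatum L 3 H).Local v),
    MeasurableSpace ((UnitaryGroup.cmDatum L 3 H).Local v ⧸ Subgroup.centralizer ({γ} : Set ((UnitaryGroup.cmDatum L 3 H).Local v)))]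
  {νH : ∀ v : HeightOneSpectrum (𝓞 ↥(maximalRealSubfield L)), Measure ((UnitaryGroup.cmDatum L 2 (Matrix.of fun i j : Fin 2 => if i.val + j.val + 1 = 2 then (1 : L) else 0)).Local v ×
      (UnitaryGroup.cmDatum L 1 (Matrix.of fun i j : Fin 1 => if i.val + j.val + 1 = 1 then (1 : L) else 0)).Local v)}
  {νG : ∀ v : HeightOneSpectrum (𝓞 ↥(maximalRealSubfield L)), Measure ((UnitaryGroup.cmDatum L 3 H).Local v)}
  {μω : HeckeCharacter L} {hμu : μω.IsUnitary}
  {Δ : ∀ v : HeightOneSpectrum (𝓞 ↥(maximalRealSubfield L)), LocalTransferFactor L H v}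
  {mH : ∀ v : HeightOneSpectrum (𝓞 ↥(maximalRealSubfield L)), OrbitalMeasureFamily ((UnitaryGroup.cmDatum L 2 (Matrix.of fun i j : Fin 2 => if i.val + j.val + 1 = 2 then (1 : L) else 0)).Local v ×
      (UnitaryGroup.cmDatum L 1 (Matrix.of fun i j : Fin 1 => if i.val + j.val + 1 = 1 then (1 : L) else 0)).Local v)}
  {mG : ∀ v : HeightOneSpectrum (𝓞 ↥(maximalRealSubfield L)), OrbitalMeasureFamily ((UnitaryGroup.cmDatum L 3 H).Local v)}

/-- **`Q_CM` AS TYPED + local transfer existence for test functions at `(Δ_v, m_{H,v}, m_{G,v})` ⇒ at every split `v` whose `G′_v` is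
non-discrete, the character of `i_G(ξ̃_v)` vanishes on ALL test functions** — for every global character `ξ` of `H`.  With ★ `LocalTransferExplicit`
(N6, print-true) this is the shape `N6 ∧ Q_CM ⊢ absurd`; the repair is to restrict [13.1.4] to test functions.
[cite: Rogawski1990, §4.9 Prop. 4.9.1 (a) p. 55; §4.13 Lemma 4.13.1 (b); §13.1 Prop. 13.1.4 p. 199] -/
theorem cmCharIdentityPackage_split_member_trace_vanishes (hQ : CMCharIdentityPackage L H hH hHd νH νG μω hμu Δ mH mG)
    (hE : ∀ v : HeightOneSpectrum (𝓞 ↥(maximalRealSubfield L)), IsLocalDeltaTransferExists L H v (Δ v) (mH v) (mG v) IsLocSmooth IsLocSmooth)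
    (ξ : OneDimAutRepH L) (v : HeightOneSpectrum (𝓞 ↥(maximalRealSubfield L)))
    (hs : ∃ w : UnitaryGroup.PlacesOver L v, IsCMField.complexConj L • w.1 ≠ w.1)
    (h1 : ¬ IsOpen ({1} : Set ((UnitaryGroup.cmDatum L 3 H).Local v)))
    (f : (UnitaryGroup.cmDatum L 3 H).Local v → ℂ) (hf : IsLocSmooth f) :
    ((cmSplitPacket L H hH hHd v (splitWitness v hs) (splitWitness_spec v hs) (ξ.splitν₀ μω (splitWitness v hs).1)
        (ξ.locψ (splitWitness v hs).1) (ξ.norm_splitν₀_apply hμu (splitWitness v hs).1)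
        (ξ.continuous_splitν₀ μω (splitWitness v hs).1) (ξ.norm_locψ_apply (splitWitness v hs).1)
        (ξ.continuous_locψ (splitWitness v hs).1)).πn).smoothTrace (νG v) f = 0 :=
  cmSplit_member_trace_vanishes h1 (hQ.split ξ v hs) (hE v) f hf

/-- **`Q_CM` AS TYPED + transfer existence ⇒ at every non-split `v` (non-discrete `G′_v`), for every Keys-labelled `πⁿ` the packet
`{πⁿ ∘ e, πˢ}` has `Tr πⁿ∘e (f) + Tr πˢ(f) = 0` for ALL test `f`.** [cite: Rogawski1990, §13.1 Prop. 13.1.4 p. 199; §12.2 p. 174] -/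
theorem cmCharIdentityPackage_nonsplit_member_traces_vanish (hQ : CMCharIdentityPackage L H hH hHd νH νG μω hμu Δ mH mG)
    (hE : ∀ v : HeightOneSpectrum (𝓞 ↥(maximalRealSubfield L)), IsLocalDeltaTransferExists L H v (Δ v) (mH v) (mG v) IsLocSmooth IsLocSmooth)
    (ξ : OneDimAutRepH L) (v : HeightOneSpectrum (𝓞 ↥(maximalRealSubfield L)))
    (hns : ∀ w : UnitaryGroup.PlacesOver L v, IsCMField.complexConj L • w.1 = w.1)
    (T : GL (Fin 3) (UnitaryGroup.LocalRing L v)) (a : UnitaryGroup.LocalRing L v) (ha : IsUnit a)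
    (h : formCongr (UnitaryGroup.conjLocal L (IsCMField.complexConj L) v) T (H.map (algebraMap L (UnitaryGroup.LocalRing L v))) =
      a • (Matrix.of fun i j : Fin 3 => if i.val + j.val + 1 = 3 then (1 : L) else 0).map (algebraMap L (UnitaryGroup.LocalRing L v)))
    [MeasurableSpace (Gqs L v ⧸ Subgroup.center (Gqs L v))] [BorelSpace (Gqs L v ⧸ Subgroup.center (Gqs L v))]
    (μZ : Measure (Gqs L v ⧸ Subgroup.center (Gqs L v))) [μZ.IsHaarMeasure] (π2 πn : IrrClass (Gqs L v))
    (hK : KeysCaseTwoLabels L v (μω.semilocalComponent L v) (torusLocalComponent L (IsCMField.complexConj L) v ξ.η)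
      (torusLocalComponent L (IsCMField.complexConj L) v ξ.ψ) π2 πn)
    (hn : ¬ πn.IsSquareIntegrable μZ)
    (h1 : ¬ IsOpen ({1} : Set ((UnitaryGroup.cmDatum L 3 H).Local v)))
    (f : (UnitaryGroup.cmDatum L 3 H).Local v → ℂ) (hf : IsLocSmooth f) :
    (IrrClass.comap (cmDatumLocalCongr L v T ha h).symm πn).smoothTrace (νG v) f +
      (hQ.nonsplit ξ v hns T a ha h μZ π2 πn hK hn).πs.smoothTrace (νG v) f = 0 :=
  cmNonsplit_member_traces_vanish h1 (hQ.nonsplit ξ v hns T a ha h μZ π2 πn hK hn) (hE v) f hf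

end Package

end Summit.HodgeConjecture.HodgeConjecture.Cruxes.H413.F0P3bQCMJunkObstruction
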